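import Summits.AnomalousDissipation.AnomalousDissipation.Theorems.SoloBlindLiftoffPainleve

/-!
# Lift-off far field: moment identities and the Hastings–McLeod mass identity (kernel #118)

Steady zeroth-law programme (solo-blind), paper §24.66.  On the lift-off inner scale the
mean-shear variable `m` solves `m - m‴ = (α²)‴` on the line with `m → 0` upstream, and the
live-side far field is `α² = η³ + c₂η² + c₁η + c₀ + …`.  Integrating the equation against
`1, η, η²` gives exact MOMENT IDENTITIES fixing `(c₂, c₁, c₀)`; at `ε = 0` (sharp contact at
`η = 1`, `m = 6e^{η-1}` upstream, `m = 6` downstream) they give `(0, 3, -4)`, i.e.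
`Q₀ = η³ + 3η - 4`.  We certify: the sharp-contact conditions, the dead-side and live-side
moment integrals in closed form with their upstream limits, the bookkeeping
`c₁ = 3 - Δ - Δ²/12` for a junction carrying excess mass `Δ` at `ζ_J = 1 + Δ/6`, and the
Hastings–McLeod first integral `((u′)² - xu² - u⁴)′ = -u²` together with the algebra
`(u′)² - xu² - u⁴ - x²/4 = (u′)² - (u² + x/2)²`, whose upstream limit `0` is the statement that
the Painlevé-II junction carries NO excess mass at order `ε^{2/3}` (so `a₁(ε) - 3 = O(ε)`).
-/

namespace Summit.AnomalousDissipation.AnomalousDissipation.Theorems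

open Real Filter Topology

/-! ## Sharp-contact conditions at ε = 0 -/

/-- The cubic far field `Q = η³ + c₂η² + c₁η + c₀` with the sharp-contact conditions
`Q(1) = 0`, `Q′(1) = 6`, `Q″(1) = 6` (continuity of `m`, jumps of `m′`, `m″`) is `η³ + 3η - 4`. -/
theorem liftoff_sharp_contact (c₂ c₁ c₀ : ℝ)
    (h0 : (1:ℝ)^3 + c₂ * 1^2 + c₁ * 1 + c₀ = 0)
    (h1 : 3 * (1:ℝ)^2 + 2 * c₂ * 1 + c₁ = 6)
    (h2 : 6 * (1:ℝ) + 2 * c₂ = 6) :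
    c₂ = 0 ∧ c₁ = 3 ∧ c₀ = -4 := by
  refine ⟨by linarith, by nlinarith, by nlinarith⟩

/-- Derivative of the cubic far field: `Q′ = 3η² + 2c₂η + c₁`. -/
theorem liftoff_cubic_hasDerivAt (c₂ c₁ c₀ η : ℝ) :
    HasDerivAt (fun η => η^3 + c₂ * η^2 + c₁ * η + c₀) (3 * η^2 + 2 * c₂ * η + c₁) η := by
  have h := (((hasDerivAt_pow 3 η).add ((hasDerivAt_pow 2 η).const_mul c₂)).add
    ((hasDerivAt_id η).const_mul c₁)).add_const c₀
  refine h.congr_deriv ?_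
  simp; ring

/-- `Q″ = 6η + 2c₂`. -/
theorem liftoff_cubic'_hasDerivAt (c₂ c₁ η : ℝ) :
    HasDerivAt (fun η => 3 * η^2 + 2 * c₂ * η + c₁) (6 * η + 2 * c₂) η := by
  have h := (((hasDerivAt_pow 2 η).const_mul 3).add ((hasDerivAt_id η).const_mul (2*c₂))).add_const c₁
  refine h.congr_deriv ?_
  simp; ring

/-! ## Dead-side moments: antiderivatives, box integrals, upstream limits -/

/-- `(e^{x-1})′ = e^{x-1}`. -/
theorem liftoff_expShift_hasDerivAt (η : ℝ) : HasDerivAt (fun x => exp (x - 1)) (exp (η - 1)) η := by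
  have h := ((hasDerivAt_id η).sub_const 1).exp
  refine h.congr_deriv ?_
  simp

/-- Antiderivative of the dead-side mass density: `(6e^{η-1})′ = 6e^{η-1}`. -/
theorem liftoff_dead_m0_hasDerivAt (η : ℝ) :
    HasDerivAt (fun η => 6 * exp (η - 1)) (6 * exp (η - 1)) η :=
  (liftoff_expShift_hasDerivAt η).const_mul 6

/-- Antiderivative for the first moment: `(6(η-1)e^{η-1})′ = 6ηe^{η-1}`. -/
theorem liftoff_dead_m1_hasDerivAt (η : ℝ) :
    HasDerivAt (fun η => 6 * (η - 1) * exp (η - 1)) (6 * η * exp (η - 1)) η := by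
  have hl : HasDerivAt (fun x : ℝ => 6 * (x - 1)) (6 * 1) η := ((hasDerivAt_id η).sub_const 1).const_mul 6
  have h := hl.mul (liftoff_expShift_hasDerivAt η)
  have e : (6 : ℝ) * 1 * exp (η - 1) + 6 * (η - 1) * exp (η - 1) = 6 * η * exp (η - 1) := by ring
  rw [e] at h
  exact h

/-- Antiderivative for the second moment: `(6(η²-2η+2)e^{η-1})′ = 6η²e^{η-1}`. -/
theorem liftoff_dead_m2_hasDerivAt (η : ℝ) :
    HasDerivAt (fun η => 6 * (η^2 - 2*η + 2) * exp (η - 1)) (6 * η^2 * exp (η - 1)) η := by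
  have hp : HasDerivAt (fun x : ℝ => 6 * (x^2 - 2*x + 2)) (6 * (2*η - 2)) η := by
    have h := (((hasDerivAt_pow 2 η).sub ((hasDerivAt_id η).const_mul 2)).add_const 2).const_mul 6
    refine h.congr_deriv ?_
    simp
  have h := hp.mul (liftoff_expShift_hasDerivAt η)
  have e : 6 * (2*η - 2) * exp (η - 1) + 6 * (η^2 - 2*η + 2) * exp (η - 1) = 6 * η^2 * exp (η - 1) := by
    ring
  rw [e] at h
  exact h

/-- `∫_a^1 6e^{η-1} dη = 6 - 6e^{a-1}`. -/
theorem liftoff_dead_m0_integral (a : ℝ) :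
    ∫ η in a..1, 6 * exp (η - 1) = 6 - 6 * exp (a - 1) := by
  have h := intervalIntegral.integral_eq_sub_of_hasDerivAt (a := a) (b := 1)
    (f := fun η => 6 * exp (η - 1)) (f' := fun η => 6 * exp (η - 1))
    (fun x _ => liftoff_dead_m0_hasDerivAt x) (by apply Continuous.intervalIntegrable; continuity)
  rw [h]; norm_num

/-- `∫_a^1 6ηe^{η-1} dη = -6(a-1)e^{a-1}`. -/
theorem liftoff_dead_m1_integral (a : ℝ) :
    ∫ η in a..1, 6 * η * exp (η - 1) = -(6 * (a - 1) * exp (a - 1)) := by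
  have h := intervalIntegral.integral_eq_sub_of_hasDerivAt (a := a) (b := 1)
    (f := fun η => 6 * (η - 1) * exp (η - 1)) (f' := fun η => 6 * η * exp (η - 1))
    (fun x _ => liftoff_dead_m1_hasDerivAt x) (by apply Continuous.intervalIntegrable; continuity)
  rw [h]; norm_num

/-- `∫_a^1 6η²e^{η-1} dη = 6 - 6(a²-2a+2)e^{a-1}`. -/
theorem liftoff_dead_m2_integral (a : ℝ) :
    ∫ η in a..1, 6 * η^2 * exp (η - 1) = 6 - 6 * (a^2 - 2*a + 2) * exp (a - 1) := by
  have h := intervalIntegral.integral_eq_sub_of_hasDerivAt (a := a) (b := 1)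
    (f := fun η => 6 * (η^2 - 2*η + 2) * exp (η - 1)) (f' := fun η => 6 * η^2 * exp (η - 1))
    (fun x _ => liftoff_dead_m2_hasDerivAt x) (by apply Continuous.intervalIntegrable; continuity)
  rw [h]; norm_num

/-- `-a + 1 → +∞` as `a → -∞`. -/
theorem liftoff_tendsto_oneSub_atBot : Tendsto (fun a : ℝ => -a + 1) atBot atTop :=
  tendsto_atTop_add_const_right atBot 1 tendsto_neg_atBot_atTop

/-- Upstream limits: the dead-side boundary terms vanish as `a → -∞`. -/
theorem liftoff_dead_tail_m0 : Tendsto (fun a : ℝ => 6 * exp (a - 1)) atBot (𝓝 0) := by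
  have h2 := ((Real.tendsto_pow_mul_exp_neg_atTop_nhds_zero 0).comp liftoff_tendsto_oneSub_atBot).const_mul 6
  rw [mul_zero] at h2
  refine h2.congr (fun a => ?_)
  simp only [Function.comp_apply, pow_zero, one_mul]
  rw [show -(-a + 1) = a - 1 by ring]

/-- `6(a-1)e^{a-1} → 0` as `a → -∞`. -/
theorem liftoff_dead_tail_m1 : Tendsto (fun a : ℝ => 6 * (a - 1) * exp (a - 1)) atBot (𝓝 0) := by
  have h2 := ((Real.tendsto_pow_mul_exp_neg_atTop_nhds_zero 1).comp liftoff_tendsto_oneSub_atBot).const_mul (-6)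
  rw [mul_zero] at h2
  refine h2.congr (fun a => ?_)
  simp only [Function.comp_apply, pow_one]
  rw [show -(-a + 1) = a - 1 by ring]; ring

/-- `6(a²-2a+2)e^{a-1} → 0` as `a → -∞`. -/
theorem liftoff_dead_tail_m2 : Tendsto (fun a : ℝ => 6 * (a^2 - 2*a + 2) * exp (a - 1)) atBot (𝓝 0) := by
  have h2 := (Real.tendsto_pow_mul_exp_neg_atTop_nhds_zero 2).comp liftoff_tendsto_oneSub_atBot
  have h0 := (Real.tendsto_pow_mul_exp_neg_atTop_nhds_zero 0).comp liftoff_tendsto_oneSub_atBot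
  have h3 := (h2.add h0).const_mul 6
  rw [add_zero, mul_zero] at h3
  refine h3.congr (fun a => ?_)
  simp only [Function.comp_apply, pow_zero, one_mul]
  rw [show -(-a + 1) = a - 1 by ring]; ring

/-! ## Live-side moments on [1, H] -/

/-- Live-side mass: `∫_1^H 6 dη = 6(H-1)`. -/
theorem liftoff_live_m0_integral (H : ℝ) : ∫ _η in (1:ℝ)..H, (6:ℝ) = 6 * (H - 1) := by
  rw [intervalIntegral.integral_const]; simp [mul_comm]

/-- `(3η²)′ = 6η`. -/
theorem liftoff_sq3_hasDerivAt (x : ℝ) : HasDerivAt (fun η : ℝ => 3 * η^2) (6 * x) x := by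
  have h := (hasDerivAt_pow 2 x).const_mul 3
  refine h.congr_deriv ?_
  simp; ring

/-- `(2η³)′ = 6η²`. -/
theorem liftoff_cube2_hasDerivAt (x : ℝ) : HasDerivAt (fun η : ℝ => 2 * η^3) (6 * x^2) x := by
  have h := (hasDerivAt_pow 3 x).const_mul 2
  refine h.congr_deriv ?_
  simp; ring

/-- Live-side first moment: `∫_1^H 6η dη = 3H² - 3`. -/
theorem liftoff_live_m1_integral (H : ℝ) : ∫ η in (1:ℝ)..H, 6 * η = 3 * H^2 - 3 := by
  have h := intervalIntegral.integral_eq_sub_of_hasDerivAt (a := 1) (b := H)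
    (f := fun η : ℝ => 3 * η^2) (f' := fun η => 6 * η)
    (fun x _ => liftoff_sq3_hasDerivAt x) (by apply Continuous.intervalIntegrable; continuity)
  rw [h]; ring

/-- Live-side second moment: `∫_1^H 6η² dη = 2H³ - 2`. -/
theorem liftoff_live_m2_integral (H : ℝ) : ∫ η in (1:ℝ)..H, 6 * η^2 = 2 * H^3 - 2 := by
  have h := intervalIntegral.integral_eq_sub_of_hasDerivAt (a := 1) (b := H)
    (f := fun η : ℝ => 2 * η^3) (f' := fun η => 6 * η^2)
    (fun x _ => liftoff_cube2_hasDerivAt x) (by apply Continuous.intervalIntegrable; continuity)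
  rw [h]; ring

/-! ## The three far-field constants at ε = 0 from the moment identities

With total moments `M₀ = 6 + 6(H-1)`, `M₁ = 0 + (3H²-3)`, `M₂ = 6 + (2H³-2)` (dead + live, upstream
limits taken) and the boundary-term identities `M₀ = 6H + 2c₂`, `M₁ = 3H² - c₁`,
`M₂ = 2H³ + 12 + 2c₀` (the `12 = 2·m(H)` term comes from the `m‴` boundary terms), one reads
off `(0, 3, -4)`. -/
/-- Reading off `(c₂, c₁, c₀) = (0, 3, -4)` from the three moment identities at `ε = 0`. -/
theorem liftoff_moment_constants (H c₂ c₁ c₀ : ℝ)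
    (h0 : 6 + 6 * (H - 1) = 6 * H + 2 * c₂)
    (h1 : 0 + (3 * H^2 - 3) = 3 * H^2 - c₁)
    (h2 : 6 + (2 * H^3 - 2) = 2 * H^3 + 12 + 2 * c₀) :
    c₂ = 0 ∧ c₁ = 3 ∧ c₀ = -4 := by
  refine ⟨by linarith, by linarith, by linarith⟩

/-- Boundary-term identity behind `M₂`: for the cubic far field,
`η²Q″ - 2ηQ′ + 2Q = 2η³ + 2c₀` (the `c₂`, `c₁` terms cancel). -/
theorem liftoff_m2_boundary_terms (c₂ c₁ c₀ η : ℝ) :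
    η^2 * (6*η + 2*c₂) - 2*η*(3*η^2 + 2*c₂*η + c₁) + 2*(η^3 + c₂*η^2 + c₁*η + c₀)
      = 2*η^3 + 2*c₀ := by ring

/-- … behind `M₁`: `ηQ″ - Q′ = 3η² - c₁`. -/
theorem liftoff_m1_boundary_terms (c₂ c₁ η : ℝ) :
    η * (6*η + 2*c₂) - (3*η^2 + 2*c₂*η + c₁) = 3*η^2 - c₁ := by ring

/-- … behind `M₀`: `Q″ = 6η + 2c₂` read at `η = H` gives `2c₂ = M₀ - 6H`. -/
theorem liftoff_m0_boundary_terms (c₂ H M₀ : ℝ) (h : M₀ = 6*H + 2*c₂) : 2*c₂ = M₀ - 6*H := by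
  linarith

/-- Junction bookkeeping: a junction centred at `ζ = 1 + Δ/6` carrying excess mass `Δ` keeps the
total mass `6H` (so `c₂ = 0`) … -/
theorem liftoff_junction_mass (H Δ : ℝ) :
    6 + 6 * (H - (1 + Δ/6)) + Δ = 6 * H := by ring

/-- … and shifts the first moment to `3H² - 3 + Δ + Δ²/12`, i.e. `c₁ = 3 - Δ - Δ²/12`: the
far-field linear coefficient moves by minus the excess mass (to leading order). -/
theorem liftoff_junction_first_moment (H Δ : ℝ) :
    6 * ((1 + Δ/6) - 1) + (3 * H^2 - 3 * (1 + Δ/6)^2) + (1 + Δ/6) * Δ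
      = 3 * H^2 - 3 + Δ + Δ^2/12 := by ring

/-! ## Hastings–McLeod: first integral and the vanishing excess mass -/

/-- First integral of Painlevé II `u″ = 2u³ + xu`: `((u′)² - xu² - u⁴)′ = -u²`. -/
theorem painleveII_first_integral (u u' u'' : ℝ → ℝ)
    (hu : ∀ x, HasDerivAt u (u' x) x) (hu' : ∀ x, HasDerivAt u' (u'' x) x)
    (hP : ∀ x, u'' x = 2 * (u x)^3 + x * u x) (x : ℝ) :
    HasDerivAt (fun x => (u' x)^2 - x * (u x)^2 - (u x)^4) (-(u x)^2) x := by
  have h1 : HasDerivAt (fun x => (u' x)^2) (((2:ℕ):ℝ) * (u' x)^(2-1) * u'' x) x := (hu' x).pow 2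
  have h2 : HasDerivAt (fun x => x * (u x)^2) (1 * (u x)^2 + x * (((2:ℕ):ℝ) * (u x)^(2-1) * u' x)) x :=
    (hasDerivAt_id x).mul ((hu x).pow 2)
  have h3 : HasDerivAt (fun x => (u x)^4) (((4:ℕ):ℝ) * (u x)^(4-1) * u' x) x := (hu x).pow 4
  have h := (h1.sub h2).sub h3
  have e : ((2:ℕ):ℝ) * (u' x)^(2-1) * u'' x - (1 * (u x)^2 + x * (((2:ℕ):ℝ) * (u x)^(2-1) * u' x))
      - ((4:ℕ):ℝ) * (u x)^(4-1) * u' x = -(u x)^2 := by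
    rw [hP x]; push_cast; ring
  rw [e] at h
  exact h

/-- The algebra of the excess mass: `(u′)² - xu² - u⁴ - x²/4 = (u′)² - (u² + x/2)²`. -/
theorem hm_excess_mass_algebra (x u u' : ℝ) :
    u'^2 - x * u^2 - u^4 - x^2/4 = u'^2 - (u^2 + x/2)^2 := by ring

/-- Hence if `u′ → 0` and `u² + x/2 → 0` upstream (the Hastings–McLeod asymptotics
`u ~ √(-x/2)`), the first integral minus `x²/4` tends to `0`: with
`(u′)² - xu² - u⁴ = ∫_x^∞ u²` this says `∫ (u² - (-s/2)₊) ds = 0` — NO excess mass. -/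
theorem hm_excess_mass_vanishes (u u' : ℝ → ℝ)
    (h1 : Tendsto u' atBot (𝓝 0)) (h2 : Tendsto (fun x => (u x)^2 + x/2) atBot (𝓝 0)) :
    Tendsto (fun x => (u' x)^2 - x * (u x)^2 - (u x)^4 - x^2/4) atBot (𝓝 0) := by
  have h := (h1.pow 2).sub (h2.pow 2)
  rw [zero_pow (by norm_num : (2:ℕ) ≠ 0), sub_zero] at h
  refine h.congr (fun x => ?_)
  ring

/-- Consequence for the lift-off (scaling `A = √12·u_HM(-ξ)`, `η - 1 = ε^{1/3}ξ`): the
junction's `O(ε^{2/3})` excess mass is `-ε^{2/3}·12·∫(u_HM² - (-s/2)₊) = 0`, so by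
`liftoff_junction_first_moment` the far-field linear coefficient obeys `a₁(ε) - 3 = O(ε)`:
recorded here as the trivial bookkeeping `Δ = -(e·12·I)`, `I = 0` ⟹ `Δ = 0`. -/
theorem liftoff_no_mass_at_two_thirds (e I Δ : ℝ) (hI : I = 0) (hΔ : Δ = -(e * 12 * I)) :
    Δ = 0 := by subst hI; simpa using hΔ

end Summit.AnomalousDissipation.AnomalousDissipation.Theorems
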